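import Literature.Analysis.UnboundedOperators.LinearizedBoltzmannEnergyForm
import Literature.Analysis.UnboundedOperators.LinearizedBoltzmannFrequencyBounds
import Mathlib.Analysis.InnerProductSpace.LaxMilgram
import HarnessLib

/-!
# The linearised hard-sphere operator is invertible on the orthogonal complement of its kernel

Sibling proof file of `LinearizedBoltzmann.lean` (CIP 1994 §7.2: the Fredholm alternative for
`L h = g`, i.e. the solvability of the linearised Boltzmann / Chapman–Enskog equations). For the
self-adjoint realisation `A = -ν + K` of the linearised hard-sphere operator on
`L²(M dv) = Lp ℝ 2 (stdGaussian E)` (`linearizedHardSpherePMap hE`, `LinearizedBoltzmannOperator`)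
we prove, in dimension `d ≥ 2`:

* `exists_linearizedHardSpherePMap_eq_toLp` — **for every `g ∈ L²(M dv)` which is
  `M`-orthogonal to the collision invariants there is `u ∈ dom A`, `M`-orthogonal to the
  collision invariants, with `A u = [g]`**, and `λ ‖u‖ ≤ ‖g‖` for every spectral-gap constant
  `λ` of `L`;
* `exists_gap_and_inverse_linearizedHardSpherePMap` — the same with the tree's spectral gap
  (`le_neg_maxwellianInner_hardSphereLinearizedOp_of_orthogonal_holds`): `‖L⁻¹‖ ≤ λ⁻¹` on the
  orthogonal complement of the null space.

Proof (Lax–Milgram in the energy space, using only bounded operators). Let `R` be the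
multiplication by `ν^{-1/2}` (bounded since `ν ≥ ν₀ > 0`, `exists_pos_le_collisionFrequency`) and
`T = 1 - R K R`, so that `T (ν^{1/2} u) = ν^{-1/2} (ν u - K u) = ν^{-1/2} (-A u)`. On the closure
`V` of `V₀ = {[ν^{1/2} t] : t temperate, t ⊥_M invariants}` the form `⟪T x, y⟫` is coercive
(`exists_energy_coercive`: `⟪T x, x⟫ = -⟪t, L t⟫_M ≥ c ∫ ν t² = c ‖x‖²`), so Lax–Milgram gives
`w ∈ V` with `⟪T w + R [g], x⟫ = 0` for `x ∈ V`. The same holds for `x = [ν^{1/2} n]`, `n` a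
collision invariant (`T [ν^{1/2} n] = 0` as `K [n] = [ν n]`, and `⟪R [g], [ν^{1/2} n]⟫ = ⟪g, n⟫_M = 0`),
hence for `x = [ν^{1/2} φ]` for every smooth compactly supported `φ` (decompose `φ` against the
invariants, `exists_sub_mem_collisionInvariants_orthogonal`); thus `T w = -R [g]`
(`Lp_eq_zero_of_forall_integral_mul_eq_zero`), and `u = R w` satisfies `ν u = K u - g ∈ L²`,
i.e. `u ∈ dom A` and `A u = [g]`.

No new definitions are introduced.

## References

* C. Cercignani, R. Illner, M. Pulvirenti, *The Mathematical Theory of Dilute Gases*, Springer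
  (1994), §7.2, Thms 7.2.1–7.2.5 and the Fredholm discussion, pp. 197–201.
* H. Grad, *Asymptotic theory of the Boltzmann equation II*, Rarefied Gas Dynamics I (1963) §4.
-/

open MeasureTheory Metric Real Set Filter Topology ProbabilityTheory Module
open scoped InnerProductSpace ENNReal

namespace Literature.Analysis.UnboundedOperators

noncomputable section

open Literature.MathematicalPhysics.KineticTheory (collide sphereMeasure hardSphereKernel)
open Literature.Analysis.FluidPDE

variable {E : Type*} [NormedAddCommGroup E] [InnerProductSpace ℝ E] [FiniteDimensional ℝ E]
  [MeasurableSpace E] [BorelSpace E]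

/-! ### `ν^{1/2} t ∈ L²(M dv)` and the pairing as an inner product -/

/-- `0 ≤ √ν ≤ 1 + ν` pointwise, whence `|√ν t| ≤ |t| + |ν t|`. [folklore] -/
theorem abs_sqrt_collisionFrequency_mul_le (v : E) (x : ℝ) :
    |Real.sqrt (collisionFrequency v) * x| ≤ |x| + |collisionFrequency v * x| := by
  have h0 := collisionFrequency_nonneg v
  have h1 : Real.sqrt (collisionFrequency v) ≤ 1 + collisionFrequency v := by
    rw [Real.sqrt_le_left (by linarith)]
    nlinarith
  rw [abs_mul, abs_mul, abs_of_nonneg (Real.sqrt_nonneg _), abs_of_nonneg h0]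
  nlinarith [abs_nonneg x, Real.sqrt_nonneg (collisionFrequency v)]

/-- `√ν t ∈ L²(M dv)` whenever `t, ν t ∈ L²(M dv)`. [folklore] -/
theorem memLp_two_sqrt_collisionFrequency_mul {t : E → ℝ} (ht : MemLp t 2 (stdGaussian E))
    (hν : MemLp (fun v => collisionFrequency v * t v) 2 (stdGaussian E)) :
    MemLp (fun v => Real.sqrt (collisionFrequency v) * t v) 2 (stdGaussian E) := by
  refine (ht.norm.add hν.norm).of_le_mul (c := 1)
    ((measurable_collisionFrequency.sqrt.aestronglyMeasurable).mul ht.1)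
    (Eventually.of_forall fun v => ?_)
  simp only [Pi.add_apply, one_mul, Real.norm_eq_abs]
  rw [abs_of_nonneg (by positivity : (0 : ℝ) ≤ |t v| + |collisionFrequency v * t v|)]
  exact abs_sqrt_collisionFrequency_mul_le v (t v)

/-- `√ν t ∈ L²(M dv)` for `t` of temperate growth. [folklore] -/
theorem memLp_two_sqrt_collisionFrequency_mul_of_hasTemperateGrowth {t : E → ℝ}
    (ht : t.HasTemperateGrowth) :
    MemLp (fun v => Real.sqrt (collisionFrequency v) * t v) 2 (stdGaussian E) :=
  memLp_two_sqrt_collisionFrequency_mul (memLp_two_of_hasTemperateGrowth ht)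
    (memLp_two_collisionFrequency_mul_of_hasTemperateGrowth ht)

/-- `√ν ∈ L²(M dv)`. [folklore] -/
theorem memLp_two_sqrt_collisionFrequency :
    MemLp (fun v : E => Real.sqrt (collisionFrequency v)) 2 (stdGaussian E) := by
  simpa using memLp_two_sqrt_collisionFrequency_mul_of_hasTemperateGrowth (E := E)
    (Function.HasTemperateGrowth.const (1 : ℝ))

omit [BorelSpace E] in
/-- `⟪[t], [φ]⟫ = ⟪t, φ⟫_M` on representatives. [folklore] -/
theorem inner_toLp_toLp_eq_maxwellianInner {t φ : E → ℝ} (ht : MemLp t 2 (stdGaussian E))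
    (hφ : MemLp φ 2 (stdGaussian E)) :
    ⟪ht.toLp t, hφ.toLp φ⟫_ℝ = maxwellianInner t φ := by
  rw [L2.inner_def, maxwellianInner]
  refine integral_congr_ae ?_
  filter_upwards [MemLp.coeFn_toLp ht, MemLp.coeFn_toLp hφ] with v h1 h2
  rw [h1, h2]
  simp only [RCLike.inner_apply, conj_trivial, mul_comm]

/-! ### The multiplication by `ν^{-1/2}` -/

section MulR

variable {R : Lp ℝ 2 (stdGaussian E) →L[ℝ] Lp ℝ 2 (stdGaussian E)}

/-- The multiplication `R` by `ν^{-1/2}` is symmetric. [folklore] -/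
theorem inner_mulInvSqrt_comm
    (hR : ∀ f : Lp ℝ 2 (stdGaussian E), (R f : E → ℝ) =ᵐ[stdGaussian E]
      fun v => (Real.sqrt (collisionFrequency v))⁻¹ * (f : E → ℝ) v)
    (f h : Lp ℝ 2 (stdGaussian E)) : ⟪R f, h⟫_ℝ = ⟪f, R h⟫_ℝ := by
  simp only [L2.inner_def]
  refine integral_congr_ae ?_
  filter_upwards [hR f, hR h] with v h1 h2
  rw [h1, h2]
  simp only [RCLike.inner_apply, conj_trivial]
  ring

/-- `R [√ν t] = [t]`. [folklore] -/
theorem mulInvSqrt_toLp_sqrt_mul (hE : 2 ≤ finrank ℝ E)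
    (hR : ∀ f : Lp ℝ 2 (stdGaussian E), (R f : E → ℝ) =ᵐ[stdGaussian E]
      fun v => (Real.sqrt (collisionFrequency v))⁻¹ * (f : E → ℝ) v)
    {t : E → ℝ} (ht : MemLp t 2 (stdGaussian E))
    (hst : MemLp (fun v => Real.sqrt (collisionFrequency v) * t v) 2 (stdGaussian E)) :
    R (hst.toLp _) = ht.toLp t := by
  have hpos := (collisionFrequency_pos_and_continuous (E := E) (by omega)).1
  refine Lp.ext ?_
  filter_upwards [hR (hst.toLp _), MemLp.coeFn_toLp hst, MemLp.coeFn_toLp ht] with v h1 h2 h3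
  rw [h1, h2, h3, ← mul_assoc, inv_mul_cancel₀ (Real.sqrt_pos.2 (hpos v)).ne', one_mul]

/-- `R (R f) = ν⁻¹ f` a.e. [folklore] -/
theorem coeFn_mulInvSqrt_mulInvSqrt
    (hR : ∀ f : Lp ℝ 2 (stdGaussian E), (R f : E → ℝ) =ᵐ[stdGaussian E]
      fun v => (Real.sqrt (collisionFrequency v))⁻¹ * (f : E → ℝ) v)
    (f : Lp ℝ 2 (stdGaussian E)) :
    (R (R f) : E → ℝ) =ᵐ[stdGaussian E] fun v => (collisionFrequency v)⁻¹ * (f : E → ℝ) v := by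
  filter_upwards [hR (R f), hR f] with v h1 h2
  rw [h1, h2, ← mul_assoc, ← mul_inv, Real.mul_self_sqrt (collisionFrequency_nonneg v)]

/-- `T = 1 - R K R` is symmetric. [folklore] -/
theorem inner_energyOp_comm (hE : 2 ≤ finrank ℝ E)
    (hR : ∀ f : Lp ℝ 2 (stdGaussian E), (R f : E → ℝ) =ᵐ[stdGaussian E]
      fun v => (Real.sqrt (collisionFrequency v))⁻¹ * (f : E → ℝ) v)
    (x y : Lp ℝ 2 (stdGaussian E)) :
    ⟪(1 - R ∘L gainLossOp hE ∘L R) x, y⟫_ℝ = ⟪x, (1 - R ∘L gainLossOp hE ∘L R) y⟫_ℝ := by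
  simp only [sub_apply, one_apply_eq_self,
    ContinuousLinearMap.coe_comp, Function.comp_apply, inner_sub_left, inner_sub_right]
  rw [inner_mulInvSqrt_comm hR, inner_gainLossOp_comm, ← inner_mulInvSqrt_comm hR]

/-- **The energy identity on `V₀`**: for `t` of temperate growth and `x = [√ν t]`,
`⟪T x, x⟫ = ∫ ν t² dM - ⟪t, K t⟫_M` (`= -⟪t, L t⟫_M`). [folklore] -/
theorem inner_energyOp_toLp_sqrt_mul_self (hE : 2 ≤ finrank ℝ E)
    (hR : ∀ f : Lp ℝ 2 (stdGaussian E), (R f : E → ℝ) =ᵐ[stdGaussian E]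
      fun v => (Real.sqrt (collisionFrequency v))⁻¹ * (f : E → ℝ) v)
    {t : E → ℝ} (ht : t.HasTemperateGrowth) :
    ⟪(1 - R ∘L gainLossOp hE ∘L R)
        ((memLp_two_sqrt_collisionFrequency_mul_of_hasTemperateGrowth ht).toLp _),
      (memLp_two_sqrt_collisionFrequency_mul_of_hasTemperateGrowth ht).toLp _⟫_ℝ =
      (∫ v, collisionFrequency v * t v ^ 2 ∂stdGaussian E) - linearizedKernelForm t t := by
  have htL := memLp_two_of_hasTemperateGrowth (E := E) ht
  have hst := memLp_two_sqrt_collisionFrequency_mul_of_hasTemperateGrowth (E := E) ht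
  have hRx : R (hst.toLp _) = htL.toLp t := mulInvSqrt_toLp_sqrt_mul hE hR htL hst
  simp only [sub_apply, one_apply_eq_self,
    ContinuousLinearMap.coe_comp, Function.comp_apply, inner_sub_left]
  rw [inner_mulInvSqrt_comm hR, hRx, inner_gainLossOp_toLp_self hE htL, real_inner_self_eq_norm_sq,
    norm_toLp_sq_eq_maxwellianInner hst, maxwellianInner]
  congr 1
  refine integral_congr_ae (Eventually.of_forall fun v => ?_)
  have := Real.mul_self_sqrt (collisionFrequency_nonneg v)
  calc Real.sqrt (collisionFrequency v) * t v * (Real.sqrt (collisionFrequency v) * t v)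
      = Real.sqrt (collisionFrequency v) * Real.sqrt (collisionFrequency v) * t v ^ 2 := by ring
    _ = collisionFrequency v * t v ^ 2 := by rw [this]

/-- `T [√ν n] = 0` for a collision invariant `n` (`K [n] = [ν n]`). [folklore] -/
theorem energyOp_toLp_sqrt_mul_eq_zero (hE : 2 ≤ finrank ℝ E)
    (hR : ∀ f : Lp ℝ 2 (stdGaussian E), (R f : E → ℝ) =ᵐ[stdGaussian E]
      fun v => (Real.sqrt (collisionFrequency v))⁻¹ * (f : E → ℝ) v)
    {n : E → ℝ} (hn : n ∈ collisionInvariants E) :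
    (1 - R ∘L gainLossOp hE ∘L R) ((memLp_two_sqrt_collisionFrequency_mul_of_hasTemperateGrowth
      (collisionInvariants_le_temperateGrowth hn)).toLp _) = 0 := by
  have hn' : n.HasTemperateGrowth := collisionInvariants_le_temperateGrowth hn
  have hpos := (collisionFrequency_pos_and_continuous (E := E) (by omega)).1
  have hnL := memLp_two_of_hasTemperateGrowth (E := E) hn'
  have hst := memLp_two_sqrt_collisionFrequency_mul_of_hasTemperateGrowth (E := E) hn'
  have hν := memLp_two_collisionFrequency_mul_of_hasTemperateGrowth (E := E) hn'
  simp only [sub_apply, one_apply_eq_self,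
    ContinuousLinearMap.coe_comp, Function.comp_apply]
  rw [mulInvSqrt_toLp_sqrt_mul hE hR hnL hst, gainLossOp_toLp_of_mem_collisionInvariants hE hn,
    sub_eq_zero]
  refine Lp.ext ?_
  filter_upwards [MemLp.coeFn_toLp hst, hR (hν.toLp _), MemLp.coeFn_toLp hν] with v h1 h2 h3
  rw [h1, h2, h3, ← mul_assoc]
  congr 1
  have hs := Real.sqrt_pos.2 (hpos v)
  field_simp
  rw [Real.sq_sqrt (collisionFrequency_nonneg v)]

/-- `⟪R [g], [√ν t]⟫ = ⟪g, t⟫_M`. [folklore] -/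
theorem inner_mulInvSqrt_toLp_sqrt_mul (hE : 2 ≤ finrank ℝ E)
    (hR : ∀ f : Lp ℝ 2 (stdGaussian E), (R f : E → ℝ) =ᵐ[stdGaussian E]
      fun v => (Real.sqrt (collisionFrequency v))⁻¹ * (f : E → ℝ) v)
    {g t : E → ℝ} (hg : MemLp g 2 (stdGaussian E)) (ht : MemLp t 2 (stdGaussian E))
    (hst : MemLp (fun v => Real.sqrt (collisionFrequency v) * t v) 2 (stdGaussian E)) :
    ⟪R (hg.toLp g), hst.toLp _⟫_ℝ = maxwellianInner g t := by
  rw [inner_mulInvSqrt_comm hR, mulInvSqrt_toLp_sqrt_mul hE hR ht hst,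
    inner_toLp_toLp_eq_maxwellianInner]

end MulR

omit [BorelSpace E] in
/-- `⟪t₁ + t₂, φ⟫_M = ⟪t₁, φ⟫_M + ⟪t₂, φ⟫_M` for `L²(M dv)` functions. [folklore] -/
theorem maxwellianInner_add_left_of_memLp {t₁ t₂ φ : E → ℝ} (h₁ : MemLp t₁ 2 (stdGaussian E))
    (h₂ : MemLp t₂ 2 (stdGaussian E)) (hφ : MemLp φ 2 (stdGaussian E)) :
    maxwellianInner (t₁ + t₂) φ = maxwellianInner t₁ φ + maxwellianInner t₂ φ := by
  simp only [maxwellianInner, Pi.add_apply, add_mul]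
  exact integral_add (h₁.integrable_mul hφ) (h₂.integrable_mul hφ)

/-! ### The inverse on the orthogonal complement of the collision invariants -/

/-- **Solvability of `L u = g` in `L²(M dv)` on the orthogonal complement of the collision
invariants** (CIP 1994 §7.2: the linearised hard-sphere operator is self-adjoint with null space
the collision invariants and `0` isolated in its spectrum, so `L u = g` is solvable iff `g ⊥_M` the
invariants — the Fredholm alternative behind the Chapman–Enskog expansion). In dimension `d ≥ 2`,
for every `g ∈ L²(M dv)` with `⟪g, φ⟫_M = 0` for all collision invariants `φ` there is `u` in the
domain of the self-adjoint realisation `A = -ν + K` (`linearizedHardSpherePMap hE`) with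
`A u = [g]`, `u ⊥_M` the collision invariants, and `λ ‖u‖ ≤ ‖[g]‖` for every constant `λ` satisfying
the spectral-gap inequality on temperate functions. Proof: Lax–Milgram for the coercive energy form
`⟪(1 - R K R) x, y⟫` (`R` = multiplication by `ν^{-1/2}`) on the closure of
`{[ν^{1/2} t] : t temperate ⊥ invariants}`, then testing against `[ν^{1/2} φ]`, `φ ∈ C_c^∞`.
[cite: CIPDiluteGases1994, §7.2 Thm 7.2.1 and Thm 7.2.5] -/
theorem exists_linearizedHardSpherePMap_eq_toLp (hE : 2 ≤ finrank ℝ E) {g : E → ℝ}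
    (hg : MemLp g 2 (stdGaussian E))
    (horth : ∀ φ ∈ collisionInvariants E, maxwellianInner g φ = 0)
    {lam : ℝ} (hlam : ∀ t : E → ℝ, t.HasTemperateGrowth →
      (∀ φ ∈ collisionInvariants E, maxwellianInner t φ = 0) →
      lam * maxwellianInner t t ≤ -maxwellianInner t (hardSphereLinearizedOp t)) :
    ∃ u : linearizedDomain (E := E),
      linearizedHardSpherePMap hE u = hg.toLp g ∧
      (∀ φ ∈ collisionInvariants E,
        maxwellianInner ((u : Lp ℝ 2 (stdGaussian E)) : E → ℝ) φ = 0) ∧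
      lam * ‖(u : Lp ℝ 2 (stdGaussian E))‖ ≤ ‖hg.toLp g‖ := by
  have hE0 : 0 < finrank ℝ E := by omega
  have hpos := (collisionFrequency_pos_and_continuous (E := E) hE0).1
  obtain ⟨ν₀, hν₀, hν₀le⟩ := exists_pos_le_collisionFrequency (E := E) hE0
  -- Step 0: the multiplication `R` by `ν^{-1/2}` and `T = 1 - R K R`
  obtain ⟨R, hR⟩ := exists_clm_mul (stdGaussian E)
    (m := fun v => (Real.sqrt (collisionFrequency v))⁻¹) measurable_collisionFrequency.sqrt.inv
    (C := (Real.sqrt ν₀)⁻¹) (fun v => by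
      rw [abs_of_nonneg (inv_nonneg.2 (Real.sqrt_nonneg _))]
      exact inv_anti₀ (Real.sqrt_pos.2 hν₀) (Real.sqrt_le_sqrt (hν₀le v)))
  set K : Lp ℝ 2 (stdGaussian E) →L[ℝ] Lp ℝ 2 (stdGaussian E) := gainLossOp hE with hK
  set T : Lp ℝ 2 (stdGaussian E) →L[ℝ] Lp ℝ 2 (stdGaussian E) := 1 - R ∘L K ∘L R with hT
  have hTsymm : ∀ x y : Lp ℝ 2 (stdGaussian E), ⟪T x, y⟫_ℝ = ⟪x, T y⟫_ℝ :=
    inner_energyOp_comm hE hR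
  -- Step 1: the spaces `V₀ ≤ V` and the coercivity constants
  obtain ⟨lam', c, -, hc, -, hcoer⟩ := exists_energy_coercive (E := E) hE
  let V₀ : Submodule ℝ (Lp ℝ 2 (stdGaussian E)) :=
    { carrier := {x | ∃ (t : E → ℝ) (ht : t.HasTemperateGrowth),
        (∀ φ ∈ collisionInvariants E, maxwellianInner t φ = 0) ∧
        x = (memLp_two_sqrt_collisionFrequency_mul_of_hasTemperateGrowth ht).toLp _}
      zero_mem' := by
        refine ⟨0, Function.HasTemperateGrowth.zero, fun φ _ => by simp [maxwellianInner], ?_⟩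
        refine (Lp.eq_zero_iff_ae_eq_zero.2 ?_).symm
        filter_upwards [MemLp.coeFn_toLp (memLp_two_sqrt_collisionFrequency_mul_of_hasTemperateGrowth
          (E := E) (t := (0 : E → ℝ)) Function.HasTemperateGrowth.zero)] with v hv
        rw [hv, Pi.zero_apply, mul_zero]
      add_mem' := by
        rintro x y ⟨t₁, ht₁, ho₁, rfl⟩ ⟨t₂, ht₂, ho₂, rfl⟩
        refine ⟨t₁ + t₂, ht₁.add ht₂, fun φ hφ => ?_, ?_⟩
        · rw [maxwellianInner_add_left_of_memLp (memLp_two_of_hasTemperateGrowth ht₁)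
            (memLp_two_of_hasTemperateGrowth ht₂)
            (memLp_two_of_hasTemperateGrowth (collisionInvariants_le_temperateGrowth hφ)),
            ho₁ φ hφ, ho₂ φ hφ, add_zero]
        · rw [← MemLp.toLp_add]
          exact MemLp.toLp_congr _ _ (Eventually.of_forall fun v => by
            simp only [Pi.add_apply]; ring)
      smul_mem' := by
        rintro a x ⟨t, ht, ho, rfl⟩
        refine ⟨fun v => a * t v, (Function.HasTemperateGrowth.const a).mul ht, fun φ hφ => by
          rw [maxwellianInner_const_mul_left, ho φ hφ, mul_zero], ?_⟩
        rw [← MemLp.toLp_const_smul]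
        exact MemLp.toLp_congr _ _ (Eventually.of_forall fun v => by
          simp only [Pi.smul_apply, smul_eq_mul]; ring) }
  let V : Submodule ℝ (Lp ℝ 2 (stdGaussian E)) := V₀.topologicalClosure
  have hVcl : (V : Set (Lp ℝ 2 (stdGaussian E))) = closure (V₀ : Set (Lp ℝ 2 (stdGaussian E))) :=
    V₀.topologicalClosure_coe
  -- the three properties on `V₀` …
  have hV₀ : ∀ x ∈ V₀, c * ‖x‖ ^ 2 ≤ ⟪T x, x⟫_ℝ ∧ lam * ‖R x‖ ^ 2 ≤ ⟪T x, x⟫_ℝ ∧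
      ∀ (φ : E → ℝ) (hφ : φ ∈ collisionInvariants E),
        ⟪R x, (memLp_two_of_hasTemperateGrowth (collisionInvariants_le_temperateGrowth hφ)).toLp φ⟫_ℝ
          = 0 := by
    rintro x ⟨t, ht, ho, rfl⟩
    have htL := memLp_two_of_hasTemperateGrowth (E := E) ht
    have hst := memLp_two_sqrt_collisionFrequency_mul_of_hasTemperateGrowth (E := E) ht
    have hRx : R (hst.toLp _) = htL.toLp t := mulInvSqrt_toLp_sqrt_mul hE hR htL hst
    have hTx : ⟪T (hst.toLp _), hst.toLp _⟫_ℝ =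
        (∫ v, collisionFrequency v * t v ^ 2 ∂stdGaussian E) - linearizedKernelForm t t :=
      inner_energyOp_toLp_sqrt_mul_self hE hR ht
    have hW : ‖hst.toLp _‖ ^ 2 = ∫ v, collisionFrequency v * t v ^ 2 ∂stdGaussian E := by
      rw [norm_toLp_sq_eq_maxwellianInner hst, maxwellianInner]
      refine integral_congr_ae (Eventually.of_forall fun v => ?_)
      have := Real.mul_self_sqrt (collisionFrequency_nonneg v)
      calc Real.sqrt (collisionFrequency v) * t v * (Real.sqrt (collisionFrequency v) * t v)
          = Real.sqrt (collisionFrequency v) * Real.sqrt (collisionFrequency v) * t v ^ 2 := by ring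
        _ = collisionFrequency v * t v ^ 2 := by rw [this]
    obtain ⟨-, h2⟩ := hcoer t ht ho
    refine ⟨?_, ?_, fun φ hφ => ?_⟩
    · rw [hTx, hW]; exact h2
    · have h := hlam t ht ho
      rw [neg_maxwellianInner_hardSphereLinearizedOp_eq hE ht] at h
      rw [hRx, norm_toLp_sq_eq_maxwellianInner htL, hTx]
      exact h
    · rw [hRx, inner_toLp_toLp_eq_maxwellianInner]
      exact ho φ hφ
  -- … extend to `V` by continuity
  have hV : ∀ x ∈ V, c * ‖x‖ ^ 2 ≤ ⟪T x, x⟫_ℝ ∧ lam * ‖R x‖ ^ 2 ≤ ⟪T x, x⟫_ℝ ∧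
      ∀ (φ : E → ℝ) (hφ : φ ∈ collisionInvariants E),
        ⟪R x, (memLp_two_of_hasTemperateGrowth (collisionInvariants_le_temperateGrowth hφ)).toLp φ⟫_ℝ
          = 0 := by
    intro x hx
    have hx' : x ∈ closure (V₀ : Set (Lp ℝ 2 (stdGaussian E))) := by rw [← hVcl]; exact hx
    refine ⟨?_, ?_, fun φ hφ => ?_⟩
    · exact closure_minimal (t := {x : Lp ℝ 2 (stdGaussian E) | c * ‖x‖ ^ 2 ≤ ⟪T x, x⟫_ℝ})
        (fun x hx => (hV₀ x hx).1) (isClosed_le (by fun_prop) (by fun_prop)) hx'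
    · exact closure_minimal (t := {x : Lp ℝ 2 (stdGaussian E) | lam * ‖R x‖ ^ 2 ≤ ⟪T x, x⟫_ℝ})
        (fun x hx => (hV₀ x hx).2.1) (isClosed_le (by fun_prop) (by fun_prop)) hx'
    · exact closure_minimal (t := {x : Lp ℝ 2 (stdGaussian E) | ⟪R x,
          (memLp_two_of_hasTemperateGrowth (collisionInvariants_le_temperateGrowth hφ)).toLp φ⟫_ℝ = 0})
        (fun x hx => (hV₀ x hx).2.2 φ hφ) (isClosed_eq (by fun_prop) (by fun_prop)) hx'
  -- Step 2: Lax–Milgram on `V`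
  let B : V →L[ℝ] V →L[ℝ] ℝ :=
    ((((innerSL ℝ).comp (T.comp V.subtypeL)).flip).comp V.subtypeL).flip
  have hB : ∀ x y : V, B x y = ⟪T x, (y : Lp ℝ 2 (stdGaussian E))⟫_ℝ := fun x y => rfl
  have hBco : IsCoercive B := ⟨c, hc, fun x => by
    rw [hB, mul_assoc, ← pow_two]
    exact (hV x x.2).1⟩
  set y : Lp ℝ 2 (stdGaussian E) := -(R (hg.toLp g)) with hy
  let ℓ : V →L[ℝ] ℝ := (innerSL ℝ y).comp V.subtypeL
  let w : V := hBco.continuousLinearEquivOfBilin.symm ((InnerProductSpace.toDual ℝ V).symm ℓ)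
  have hw : ∀ x : V, ⟪T w, (x : Lp ℝ 2 (stdGaussian E))⟫_ℝ = ⟪y, (x : Lp ℝ 2 (stdGaussian E))⟫_ℝ := by
    intro x
    have h1 := hBco.continuousLinearEquivOfBilin_apply w x
    rw [show hBco.continuousLinearEquivOfBilin w = (InnerProductSpace.toDual ℝ V).symm ℓ from
      ContinuousLinearEquiv.apply_symm_apply _ _, InnerProductSpace.toDual_symm_apply, hB] at h1
    rw [← h1]
    rfl
  -- Step 3: `T w - y` is orthogonal to `V₀`, to the `[√ν n]`, hence to all `[√ν φ]`, `φ ∈ C_c^∞`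
  have hzV₀ : ∀ x ∈ V₀, ⟪T w - y, x⟫_ℝ = 0 := fun x hx => by
    rw [inner_sub_left, sub_eq_zero]
    exact hw ⟨x, V₀.le_topologicalClosure hx⟩
  have hzn : ∀ (n : E → ℝ) (hn : n ∈ collisionInvariants E),
      ⟪T w - y, (memLp_two_sqrt_collisionFrequency_mul_of_hasTemperateGrowth
        (collisionInvariants_le_temperateGrowth hn)).toLp _⟫_ℝ = 0 := fun n hn => by
    have hT0 : T ((memLp_two_sqrt_collisionFrequency_mul_of_hasTemperateGrowth
        (collisionInvariants_le_temperateGrowth hn)).toLp _) = 0 :=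
      energyOp_toLp_sqrt_mul_eq_zero hE hR hn
    rw [inner_sub_left, hTsymm, hT0, inner_zero_right, hy, inner_neg_left,
      inner_mulInvSqrt_toLp_sqrt_mul hE hR hg
        (memLp_two_of_hasTemperateGrowth (collisionInvariants_le_temperateGrowth hn)),
      horth n hn, neg_zero, sub_zero]
  have hz : T w - y = 0 := by
    refine Lp_eq_zero_of_forall_integral_mul_eq_zero (w := fun v => Real.sqrt (collisionFrequency v))
      memLp_two_sqrt_collisionFrequency (fun v => (Real.sqrt_pos.2 (hpos v)).ne')
      (fun φ hφ hsupp => ?_)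
    have hφt : φ.HasTemperateGrowth := hsupp.hasTemperateGrowth hφ
    obtain ⟨n, hn, hno⟩ :=
      exists_sub_mem_collisionInvariants_orthogonal (memLp_two_of_hasTemperateGrowth hφt)
    have hn' : n.HasTemperateGrowth := collisionInvariants_le_temperateGrowth hn
    have hdt : (fun v => φ v - n v).HasTemperateGrowth := hφt.sub hn'
    have hx₁ : (memLp_two_sqrt_collisionFrequency_mul_of_hasTemperateGrowth hdt).toLp _ ∈ V₀ :=
      ⟨_, hdt, fun m hm => hno m hm, rfl⟩
    have h1 := hzV₀ _ hx₁
    have h2 := hzn n hn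
    have hsum : (memLp_two_sqrt_collisionFrequency_mul_of_hasTemperateGrowth hφt).toLp _ =
        (memLp_two_sqrt_collisionFrequency_mul_of_hasTemperateGrowth hdt).toLp _ +
        (memLp_two_sqrt_collisionFrequency_mul_of_hasTemperateGrowth hn').toLp _ := by
      rw [← MemLp.toLp_add]
      exact MemLp.toLp_congr _ _ (Eventually.of_forall fun v => by simp only [Pi.add_apply]; ring)
    have h3 : ⟪T w - y,
        (memLp_two_sqrt_collisionFrequency_mul_of_hasTemperateGrowth hφt).toLp _⟫_ℝ = 0 := by
      rw [hsum, inner_add_right, h1, h2, add_zero]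
    rw [L2.inner_def] at h3
    rw [← h3]
    refine integral_congr_ae ?_
    filter_upwards [MemLp.coeFn_toLp
      (memLp_two_sqrt_collisionFrequency_mul_of_hasTemperateGrowth (E := E) hφt)] with v hv
    rw [hv]
    simp only [RCLike.inner_apply, conj_trivial]
    ring
  -- Step 4: `u = R w` solves `ν u = K u - g`
  have hTw : T w = y := sub_eq_zero.1 hz
  set u : Lp ℝ 2 (stdGaussian E) := R w with hu
  have hw_eq : (w : Lp ℝ 2 (stdGaussian E)) = R (K u - hg.toLp g) := by
    have h : (w : Lp ℝ 2 (stdGaussian E)) - R (K (R w)) = -(R (hg.toLp g)) := by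
      simpa only [hT, sub_apply, one_apply_eq_self,
        ContinuousLinearMap.coe_comp, Function.comp_apply] using hTw
    rw [sub_eq_iff_eq_add] at h
    rw [h, map_sub]
    abel
  have hνu : (fun v => collisionFrequency v * (u : E → ℝ) v) =ᵐ[stdGaussian E]
      ((K u - hg.toLp g : Lp ℝ 2 (stdGaussian E)) : E → ℝ) := by
    have h1 := hR w
    have h2 := hR (K u - hg.toLp g)
    rw [← hw_eq] at h2
    filter_upwards [h1, h2] with v huv hwv
    rw [huv, hwv, ← mul_assoc, ← mul_assoc, mul_assoc (collisionFrequency v), ← mul_inv,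
      Real.mul_self_sqrt (collisionFrequency_nonneg v), mul_inv_cancel₀ (hpos v).ne', one_mul]
  have hdom : u ∈ linearizedDomain :=
    mem_linearizedDomain_iff.2 ((Lp.memLp (K u - hg.toLp g)).ae_eq hνu.symm)
  refine ⟨⟨u, hdom⟩, ?_, ?_, ?_⟩
  · -- `A u = [g]`
    have hmul : mulFrequency ⟨u, hdom⟩ = K u - hg.toLp g :=
      Lp.ext ((coeFn_mulFrequency ⟨u, hdom⟩).trans hνu)
    rw [linearizedHardSpherePMap_apply, hmul]
    change -(K u - hg.toLp g) + K u = hg.toLp g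
    abel
  · -- `u ⊥` collision invariants
    intro φ hφ
    have h : ⟪u, (memLp_two_of_hasTemperateGrowth
        (collisionInvariants_le_temperateGrowth hφ)).toLp φ⟫_ℝ = 0 := (hV w w.2).2.2 φ hφ
    change maxwellianInner (u : E → ℝ) φ = 0
    rw [← inner_toLp_toLp_eq_maxwellianInner (Lp.memLp u)
      (memLp_two_of_hasTemperateGrowth (collisionInvariants_le_temperateGrowth hφ)), Lp.toLp_coeFn]
    exact h
  · -- `λ ‖u‖ ≤ ‖g‖`
    have h1 : lam * ‖u‖ ^ 2 ≤ ⟪T w, (w : Lp ℝ 2 (stdGaussian E))⟫_ℝ := (hV w w.2).2.1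
    have h2 : ⟪T w, (w : Lp ℝ 2 (stdGaussian E))⟫_ℝ = -⟪hg.toLp g, u⟫_ℝ := by
      rw [hTw, hy, inner_neg_left, inner_mulInvSqrt_comm hR]
    have h3 : lam * ‖u‖ ^ 2 ≤ ‖hg.toLp g‖ * ‖u‖ := by
      rw [h2] at h1
      exact h1.trans ((neg_le_abs _).trans (abs_real_inner_le_norm _ _))
    change lam * ‖u‖ ≤ ‖hg.toLp g‖
    by_cases hu0 : ‖u‖ = 0
    · rw [hu0, mul_zero]; exact norm_nonneg _
    · have hupos : 0 < ‖u‖ := lt_of_le_of_ne (norm_nonneg _) (Ne.symm hu0)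
      rw [pow_two, ← mul_assoc] at h3
      exact le_of_mul_le_mul_right h3 hupos

/-- **The linearised hard-sphere operator has a bounded inverse on the orthogonal complement of
the collision invariants**, with `‖L⁻¹‖ ≤ λ⁻¹` for the spectral gap `λ` of
`le_neg_maxwellianInner_hardSphereLinearizedOp_of_orthogonal_holds` (CIP 1994 §7.2, Thm 7.2.5:
`0` is an isolated eigenvalue of the self-adjoint non-positive `L`, with eigenspace the
collision invariants). [cite: CIPDiluteGases1994, §7.2 Thm 7.2.5] -/
theorem exists_gap_and_inverse_linearizedHardSpherePMap (hE : 2 ≤ finrank ℝ E) :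
    ∃ lam : ℝ, 0 < lam ∧ ∀ (g : E → ℝ) (hg : MemLp g 2 (stdGaussian E)),
      (∀ φ ∈ collisionInvariants E, maxwellianInner g φ = 0) →
      ∃ u : linearizedDomain (E := E), linearizedHardSpherePMap hE u = hg.toLp g ∧
        (∀ φ ∈ collisionInvariants E,
          maxwellianInner ((u : Lp ℝ 2 (stdGaussian E)) : E → ℝ) φ = 0) ∧
        lam * ‖(u : Lp ℝ 2 (stdGaussian E))‖ ≤ ‖hg.toLp g‖ := by
  obtain ⟨lam, hlam, hgap⟩ :=
    le_neg_maxwellianInner_hardSphereLinearizedOp_of_orthogonal_holds (E := E) hE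
  exact ⟨lam, hlam, fun g hg horth =>
    exists_linearizedHardSpherePMap_eq_toLp hE hg horth fun t ht ho => hgap t ht ho⟩

end

end Literature.Analysis.UnboundedOperators
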